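import Summits.AtomisticToContinuum.Crystallization.Theorems.FreeSplittingCertificatesStrictSplittingRuleFarPencilWeighted
import Summits.AtomisticToContinuum.Crystallization.Theorems.FreeSplittingCertificatesStrictSplittingRuleFarPencilHcpBox

/-!
# `StrictSplittingRule` (stmt-AtomisticToContinuum-12560): the free-interface far pencil against hcp shell receipts at the true minimiser

Route `FreeSplittingCertificates`, crux r3 `StrictSplittingRule` (H12⋆ = `stub_coreJointCoercive`), unit b2b-freesplit-B gen 10.
VALUE = the single continuum statement the near-side certificate consumes (HOME FAR-LEMMA-SPEC §9 (c)) — NOT a proof of H12⋆, NOT summit progress.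

Combines `farPencil_weighted_integral_le` (weight `χ²`, exact smeared flux) with the ratio-robust shell sandwich `fpRec_le_shell_of_ratio`
(`(333/400)a⁴·fpRec ≤ fpShell` for `h² ≥ (333/500)a²`, in particular at the exact hcp-family minimiser, `ratio_of_hcpFamilyMin`):
**`farPencil_weighted_integral_le_hcpShell_min`**: for `HcpFamilyMin a h`, every `C²` compactly supported `v` (no condition at the reference site) and every
`C²` weight `χ` with `0 ∉ tsupport χ`,
`∫ χ²·Num ≤ (17/200)(400/333)·a⁻⁴·∫ χ²·|x|⁻⁶·fpShell a h (∇v) + (1/18)·∫ 2χ⟪∇χ, Φ⟫`.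
Read: FAR demand (weighted) ≤ 0.1021·a⁻⁴ × FAR shell receipts (weighted) + smeared interface flux (to be paid by NEAR).  NOT a proof of H12⋆, NOT summit progress.
-/

noncomputable section

open MeasureTheory Topology Filter
open scoped BigOperators

namespace Summit.AtomisticToContinuum.Crystallization.Theorems.StrictSplittingRuleBirth

open Literature.MathematicalPhysics.StatisticalMechanics
open Summit.AtomisticToContinuum.Crystallization.Theorems.PalmUnimodularRigidity.LayeredLawsSelectHcp

variable {v : (Fin 3 → ℝ) → (Fin 3 → ℝ)} {χ : (Fin 3 → ℝ) → ℝ}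

/-- `χ²·|x|⁻⁶·fpShell(∇v)` is integrable for `v ∈ C²` compactly supported and a `C²` weight `χ` vanishing near `0`. -/
theorem integrable_sq_mul_fpShell (hv : ContDiff ℝ 2 v) (hc : HasCompactSupport v) (hχ : ContDiff ℝ 2 χ)
    (hχ0 : (0 : Fin 3 → ℝ) ∉ tsupport χ) (a h : ℝ) :
    Integrable fun y => χ y ^ 2 * ((fpSq y)⁻¹ ^ 3 * fpShell a h (fpGrad v y)) := by
  have hGc : Continuous (fpGrad v) := continuous_fpGrad hv
  have hχc : Continuous χ := hχ.continuous
  refine fp_integrable₀ hc (fun y hy => ?_) ?_ (fun y hy => ?_)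
  · have hu := continuousAt_fpSq_inv hy
    exact ((hχc.pow 2).continuousAt).mul ((hu.pow 3).mul ((continuous_fpShell a h).comp hGc).continuousAt)
  · filter_upwards [fpGradS_eventually_zero hχ0] with y hy
    simp [hy.1]
  · have h2 : fderiv ℝ v y = 0 := image_eq_zero_of_notMem_tsupport fun h' => hy (tsupport_fderiv_subset ℝ h')
    have : fpGrad v y = fun _ _ => 0 := by funext i j; simp [fpGrad, h2]
    rw [this, fpShell_zero, mul_zero, mul_zero]

/-- **Free-interface far pencil against shell receipts, ratio-robust**: `h² ≥ (333/500)a²`, `a ≠ 0` ⇒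
`∫ χ²·Num ≤ (17/200)(400/333)a⁻⁴·∫ χ²·|x|⁻⁶·fpShell(∇v) + (1/18)·∫ 2χ⟪∇χ, Φ⟫`. -/
theorem farPencil_weighted_integral_le_hcpShell_of_ratio (hv : ContDiff ℝ 2 v) (hc : HasCompactSupport v) (hχ : ContDiff ℝ 2 χ)
    (hχ0 : (0 : Fin 3 → ℝ) ∉ tsupport χ) {a h : ℝ} (ha : a ≠ 0) (hT : 333 / 500 * a ^ 2 ≤ h ^ 2) :
    ∫ x, χ x ^ 2 * fpNum x (v x) (fpGrad v x) ≤
      17 / 200 * (400 / 333 * (a ^ 4)⁻¹) * (∫ x, χ x ^ 2 * ((fpSq x)⁻¹ ^ 3 * fpShell a h (fpGrad v x))) +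
        1 / 18 * ∫ x, 2 * χ x * fpFluxDotGrad v χ x := by
  have hmain := farPencil_weighted_integral_le hv hc hχ hχ0
  have iD := integrable_cut_receipts hv hc hχ hχ0
  have iS := integrable_sq_mul_fpShell hv hc hχ hχ0 a h
  have ha4 : 0 < a ^ 4 := by positivity
  have hpt : ∀ x, χ x ^ 2 * fpDen x (fpGrad v x) ≤
      400 / 333 * (a ^ 4)⁻¹ * (χ x ^ 2 * ((fpSq x)⁻¹ ^ 3 * fpShell a h (fpGrad v x))) := by
    intro x
    have hu : 0 ≤ (fpSq x)⁻¹ ^ 3 := pow_nonneg (inv_nonneg.2 (fpSq_nonneg x)) 3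
    have hχ2 : 0 ≤ χ x ^ 2 := sq_nonneg _
    have h1 := fpRec_le_shell_of_ratio a h hT (fpGrad v x)
    have h2 : fpRec (fpGrad v x) ≤ 400 / 333 * (a ^ 4)⁻¹ * fpShell a h (fpGrad v x) := by
      rw [show 400 / 333 * (a ^ 4)⁻¹ * fpShell a h (fpGrad v x) = (a ^ 4)⁻¹ * (400 / 333 * fpShell a h (fpGrad v x)) by ring]
      rw [le_inv_mul_iff₀ ha4]
      linarith
    have h3 : fpDen x (fpGrad v x) ≤ 400 / 333 * (a ^ 4)⁻¹ * ((fpSq x)⁻¹ ^ 3 * fpShell a h (fpGrad v x)) := by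
      unfold fpDen
      nlinarith [mul_le_mul_of_nonneg_left h2 hu]
    nlinarith [mul_le_mul_of_nonneg_left h3 hχ2]
  have h4 : ∫ x, χ x ^ 2 * fpDen x (fpGrad v x) ≤
      ∫ x, 400 / 333 * (a ^ 4)⁻¹ * (χ x ^ 2 * ((fpSq x)⁻¹ ^ 3 * fpShell a h (fpGrad v x))) :=
    integral_mono iD (iS.const_mul _) hpt
  rw [integral_const_mul] at h4
  nlinarith [hmain, h4]

/-- **THE FREE-INTERFACE FAR PENCIL AGAINST HCP SHELL RECEIPTS AT THE TRUE MINIMISER** (`HcpFamilyMin a h`): for every `C²` compactly supported `v` and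
every `C²` weight `χ` with `0 ∉ tsupport χ`,
`∫ χ²·Num ≤ (17/200)(400/333)·a⁻⁴·∫ χ²·|x|⁻⁶·Σ_{s∈shell}⟪y_s, ∇v y_s⟫² + (1/18)·∫ 2χ⟪∇χ, Φ⟫`.  NOT a proof of H12⋆, NOT summit progress. -/
theorem farPencil_weighted_integral_le_hcpShell_min (hv : ContDiff ℝ 2 v) (hc : HasCompactSupport v) (hχ : ContDiff ℝ 2 χ)
    (hχ0 : (0 : Fin 3 → ℝ) ∉ tsupport χ) {a h : ℝ} (ha : 0 < a) (hh : 0 < h) (hfam : HcpFamilyMin a h) :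
    ∫ x, χ x ^ 2 * fpNum x (v x) (fpGrad v x) ≤
      17 / 200 * (400 / 333 * (a ^ 4)⁻¹) * (∫ x, χ x ^ 2 * ((fpSq x)⁻¹ ^ 3 * fpShell a h (fpGrad v x))) +
        1 / 18 * ∫ x, 2 * χ x * fpFluxDotGrad v χ x :=
  farPencil_weighted_integral_le_hcpShell_of_ratio hv hc hχ hχ0 ha.ne' (ratio_of_hcpFamilyMin ha hh hfam)

end Summit.AtomisticToContinuum.Crystallization.Theorems.StrictSplittingRuleBirth
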